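import Summits.QuantumFields.GaugeBoot.DiagonalRPTorusTubeShape
import HarnessLib

/-!
# Small back-expansion terms of two transverse squares are tubes, II: matching and shape
(gauge-boot, L3 sequel, 9/10)

HONEST FRAMING (cell `pub-gaugeboot`, page 1 of every file): the venture produces certified bounds
on lattice expectations at stated coupling, gauge group, dimension and torus size; NOT a mass gap,
NOT a continuum limit, NOT a string tension; NOT Yang–Mills-summit-bearing (barriers
`FixedCouplingUltralocality`, `PerturbativeInvisibility`). This module is bookkeeping for a
structural NEGATIVE result (`DiagonalRPTorusInnerHalfNegativeHighDim`); it discharges nothing by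
itself.

## Content (setting of `DiagonalRPTorusTubeCover` / `DiagonalRPTorusTubeShape`)

* `match_links` / `sq_eq_of_links` — if the term is non-zero, every edge of the layer-`c` square
  `T` of the (uniform) `v`-faces is an edge of the layer-`c` square `B` of the `u`-faces
  (otherwise it is a lonely link), and then `T = B`;
* ★ **`tube_shape`** — for `Q ⊆ restPlaqs i j c`, `|Q| ≤ 8`, `T_Q(sq z, sq x) ≠ 0`
  (`δ(x) = c-1`, `δ(z) = -(c-1)`): one of four cases, `z = x + 2e_i` / `x + e_i - e_j` (two
  tubes) / `x - 2e_j`, with `Q` the corresponding set of eight ring faces;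
* the corollaries the assembly uses: **`pairT_eq_zero_of_ne_offsets`** (no tube offset ⇒ every
  term with `|Q| ≤ 8` vanishes), **`eq_tubeI_of_pairT_ne_zero`** (`z = x + 2e_i` ⇒ `Q` is the
  straight `i`-tube) and **`eq_tubeJ_of_pairT_ne_zero`** (`z = x - 2e_j` ⇒ the straight `j`-tube).

Elementary bookkeeping; no named fact.
-/

open MeasureTheory Finset Function

namespace Summit.QuantumFields.GaugeBoot

open Literature.MathematicalPhysics.QuantumFieldTheory
open Summit.Ventures.YMGap.RobustBall (one_ne_zero_of_three_le two_ne_zero_of_three_le)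

noncomputable section

namespace DiagRPTube

variable {d L : ℕ}

/-! ## Two squares with matching edges coincide -/

section Squares

variable {k l : Fin d} (hkl : k < l)

include hkl in
/-- **If every edge of `sq T` is an edge of `sq B` then `T = B`** (`L ≥ 3`; only the two
`k`-edges are used). -/
theorem sq_eq_of_links (hL : 3 ≤ L) {T B : Site d L}
    (h : ∀ a : Fin 4, ∃ b : Fin 4, link (sq k l hkl B) b = link (sq k l hkl T) a) : T = B := by
  have hkl' : k ≠ l := ne_of_lt hkl
  have hdir : ∀ b : Fin 4, eDir k l b = k → b = 0 ∨ b = 2 := by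
    intro b hb
    fin_cases b
    · exact Or.inl rfl
    · exact absurd hb (by simp [eDir]; exact hkl'.symm)
    · exact Or.inr rfl
    · exact absurd hb (by simp [eDir]; exact hkl'.symm)
  obtain ⟨b, hb⟩ := h 0
  obtain ⟨b', hb'⟩ := h 2
  rw [link_sq, link_sq] at hb hb'
  have hbd : eDir k l b = k := congrArg Prod.snd hb
  have hbd' : eDir k l b' = k := congrArg Prod.snd hb'
  have hbs : eStart k l B b = T := congrArg Prod.fst hb
  have hbs' : eStart k l B b' = T.shift l := congrArg Prod.fst hb'
  rcases hdir b hbd with rfl | rfl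
  · exact hbs.symm
  · rcases hdir b' hbd' with rfl | rfl
    · -- `B + e_l = T` and `B = T + e_l`: impossible
      simp only [eStart] at hbs hbs'
      exfalso
      rw [hbs'] at hbs
      exact shift_shift_ne hL T l hbs
    · simp only [eStart] at hbs'
      simpa [Site.shift] using hbs'.symm

end Squares

/-! ## Matching and the shape theorem -/

section Match

variable [NeZero L] {N : ℕ} {G : Type*} [Group G] [TopologicalSpace G]
  [IsTopologicalGroup G] [CompactSpace G] [MeasurableSpace G] [BorelSpace G]
  [SecondCountableTopology G] {ρ : G →* Matrix (Fin N) (Fin N) ℂ} {β : ℝ}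
  {i j k l : Fin d} (hij : i < j) (hjk : j < k) (hkl : k < l) {c : ℕ} (hc : 2 ≤ c)
  (hL : L = 2 * c) (hρ : Continuous ρ) {z₀ : G} {ω : ℂ}
  (hz₀ : ρ z₀ = ω • (1 : Matrix (Fin N) (Fin N) ℂ)) (hω : ω ≠ 1)
  {x z : Site d L} (hx : lay i j x = ((c - 1 : ℕ) : ZMod L))
  (hz : lay i j z = -((c - 1 : ℕ) : ZMod L))

section WithCover

variable {Q : Finset (Plaquette d L)} {qv qu : Fin 4 → Plaquette d L}
  (hv : ∀ a, qv a ∈ Q ∧ HasLink (qv a) (link (sq k l hkl x) a) ∧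
    (qv a = ring (hij.trans hjk) (hij.trans (hjk.trans hkl)) x a ∨
      qv a = ring hjk (hjk.trans hkl) (dn x j) a))
  (hu : ∀ a, qu a ∈ Q ∧ HasLink (qu a) (link (sq k l hkl z) a) ∧
    (qu a = ring (hij.trans hjk) (hij.trans (hjk.trans hkl)) (dn z i) a ∨
      qu a = ring hjk (hjk.trans hkl) z a))
  (hex : ∀ q ∈ Q, (∃ a, q = qv a) ∨ (∃ a, q = qu a))

include hv hu hex in
omit [NeZero L] [TopologicalSpace G] [IsTopologicalGroup G] [CompactSpace G] [MeasurableSpace G]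
  [BorelSpace G] [SecondCountableTopology G] in
/-- **The exhaustion as a set identity**: `Q = {qv a} ∪ {qu a}`. -/
theorem eq_image_union : Q = univ.image qv ∪ univ.image qu := by
  ext q
  simp only [mem_union, mem_image, mem_univ, true_and]
  constructor
  · intro hq
    rcases hex q hq with ⟨a, rfl⟩ | ⟨a, rfl⟩
    · exact Or.inl ⟨a, rfl⟩
    · exact Or.inr ⟨a, rfl⟩
  · rintro (⟨a, rfl⟩ | ⟨a, rfl⟩)
    · exact (hv a).1
    · exact (hu a).1

include hij hjk hkl hc hL hρ hz₀ hω hx hz hv hu hex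

/-- **Matching core**: if every `v`-face contains the corresponding edge of a layer-`c` square
`sq T` (and no other), and the layer-`c` transverse links of the `u`-faces are edges of `sq B`,
then a non-zero term forces every edge of `sq T` to be an edge of `sq B`. -/
theorem match_links (hT : pairT ρ β Q (sq k l hkl z) (sq k l hkl x) ≠ 0) {T B : Site d L}
    (hlayT : lay i j T = ((c : ℕ) : ZMod L))
    (hvT : ∀ a, HasLink (qv a) (link (sq k l hkl T) a))
    (hvT' : ∀ a b, HasLink (qv b) (link (sq k l hkl T) a) → b = a)
    (huB : ∀ a b, HasLink (qu b) (link (sq k l hkl T) a) →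
      link (sq k l hkl T) a = link (sq k l hkl B) b) :
    ∀ a : Fin 4, ∃ b : Fin 4, link (sq k l hkl B) b = link (sq k l hkl T) a := by
  intro a
  by_contra hno
  push Not at hno
  refine hT (pairT_eq_zero_of_lonely_vface hij hjk hkl hc hL hρ hz₀ hω hx hz hv hu hex a
    (ℓ := link (sq k l hkl T) a) (hvT a) ?_ ?_ (fun b hb h => hb (hvT' a b h)) fun b h =>
      hno b (huB a b h).symm)
  · exact not_hasLink_sq_of_lay_ne hij hjk hkl (by rw [hlayT, hx]; exact (cast_pred_ne_c hc hL).symm) a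
  · exact not_hasLink_sq_of_lay_ne hij hjk hkl
      (by rw [hlayT, hz]; exact (neg_cast_pred_ne_c hc hL).symm) a

end WithCover

include hij hjk hkl hc hL hρ hz₀ hω hx hz in
/-- ★ **THE SHAPE OF A NON-ZERO SMALL TERM**: a tube of eight ring faces from `sq x` up to
`sq z`, in one of four ways. -/
theorem tube_shape {Q : Finset (Plaquette d L)} (hQ : Q ⊆ restPlaqs i j c) (hcard : Q.card ≤ 8)
    (hT : pairT ρ β Q (sq k l hkl z) (sq k l hkl x) ≠ 0) :
    (z = (x.shift i).shift i ∧ Q = univ.image (ring (hij.trans hjk) (hij.trans (hjk.trans hkl)) x) ∪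
        univ.image (ring (hij.trans hjk) (hij.trans (hjk.trans hkl)) (x.shift i))) ∨
    (z = dn (x.shift i) j ∧ Q = univ.image (ring (hij.trans hjk) (hij.trans (hjk.trans hkl)) x) ∪
        univ.image (ring hjk (hjk.trans hkl) z)) ∨
    (z = (dn x j).shift i ∧ Q = univ.image (ring hjk (hjk.trans hkl) (dn x j)) ∪
        univ.image (ring (hij.trans hjk) (hij.trans (hjk.trans hkl)) (dn x j))) ∨
    (z = dn (dn x j) j ∧ Q = univ.image (ring hjk (hjk.trans hkl) (dn x j)) ∪
        univ.image (ring hjk (hjk.trans hkl) z)) := by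
  have hL3 : 3 ≤ L := by omega
  have hij' : i ≠ j := ne_of_lt hij
  have hik : i < k := hij.trans hjk
  have hil : i < l := hij.trans (hjk.trans hkl)
  have hjl : j < l := hjk.trans hkl
  obtain ⟨qv, qu, hv, hu, hex⟩ := cover_structure hij hjk hkl hc hL hρ hz₀ hω hx hz hQ hcard hT
  have hQeq := eq_image_union hij hjk hkl hv hu hex
  have hvu := vtypes_uniform hij hjk hkl hc hL hρ hz₀ hω hx hz hv hu hex hT
  have huu := utypes_uniform hij hjk hkl hc hL hρ hz₀ hω hx hz hv hu hex hT
  -- layers of the candidate top / bottom squares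
  have hT1 : lay i j (x.shift i) = ((c : ℕ) : ZMod L) := by
    rw [lay_shift_i hij', hx, cast_pred_add_one (L := L) hc]
  have hT2 : lay i j (dn x j) = ((c : ℕ) : ZMod L) := by
    rw [lay_dn_j hij', hx, cast_pred_add_one (L := L) hc]
  have hzc : lay i j z ≠ ((c : ℕ) : ZMod L) := by rw [hz]; exact neg_cast_pred_ne_c hc hL
  -- the `u`-faces' transverse links on the layer `c`
  have huB : ∀ (T : Site d L), lay i j T = ((c : ℕ) : ZMod L) → ∀ a b,
      HasLink (qu b) (link (sq k l hkl T) a) →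
      (qu b = ring hik hil (dn z i) b → link (sq k l hkl T) a = link (sq k l hkl (dn z i)) b) ∧
      (qu b = ring hjk hjl z b → link (sq k l hkl T) a = link (sq k l hkl (z.shift j)) b) := by
    intro T hlT a b h
    constructor
    · intro hb
      rw [hb, link_sq] at h
      rcases hasLink_ring_transverse hik hil hkl (eDir_eq_or a) h with h' | h'
      · exfalso
        rw [dn_shift] at h'
        have := lay_of_hasLink_sq hij hjk hkl (y := z) ⟨b, h'.symm⟩
        rw [lay_eStart hik.ne' hjk.ne' hil.ne' hjl.ne', hlT] at this
        exact hzc this.symm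
      · rw [link_sq]; exact h'
    · intro hb
      rw [hb, link_sq] at h
      rcases hasLink_ring_transverse hjk hjl hkl (eDir_eq_or a) h with h' | h'
      · rw [link_sq]; exact h'
      · exfalso
        have := lay_of_hasLink_sq hij hjk hkl (y := z) ⟨b, h'.symm⟩
        rw [lay_eStart hik.ne' hjk.ne' hil.ne' hjl.ne', hlT] at this
        exact hzc this.symm
  rcases hvu with hvI | hvJ
  · -- `v`-faces of type `+e_i`: top square `x + e_i`
    have hvT : ∀ a, HasLink (qv a) (link (sq k l hkl (x.shift i)) a) := fun a => by
      rw [hvI a]; exact hasLink_ring_high hik hil hkl x a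
    have hvT' : ∀ a b, HasLink (qv b) (link (sq k l hkl (x.shift i)) a) → b = a := fun a b h => by
      rw [hvI b] at h; exact eq_of_hasLink_ring_high hik hil hkl hL3 h
    rcases huu with huI | huJ
    · left
      have hTB := sq_eq_of_links hkl hL3 (match_links hij hjk hkl hc hL hρ hz₀ hω hx hz hv hu hex hT hT1 hvT hvT' fun a b h => ((huB _ hT1 a b h).1 (huI b)))
      have hzx : z = (x.shift i).shift i := by rw [hTB, dn_shift]
      refine ⟨hzx, ?_⟩
      have hqv : qv = ring hik hil x := funext hvI
      have hqu : qu = ring hik hil (x.shift i) := funext fun a => by rw [huI a, ← hTB]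
      rw [hQeq, hqv, hqu]
    · right; left
      have hTB := sq_eq_of_links hkl hL3 (match_links hij hjk hkl hc hL hρ hz₀ hω hx hz hv hu hex hT hT1 hvT hvT' fun a b h => ((huB _ hT1 a b h).2 (huJ b)))
      have hzx : z = dn (x.shift i) j := by rw [hTB, shift_dn]
      refine ⟨hzx, ?_⟩
      have hqv : qv = ring hik hil x := funext hvI
      have hqu : qu = ring hjk hjl z := funext huJ
      rw [hQeq, hqv, hqu]
  · -- `v`-faces of type `-e_j`: top square `x - e_j`
    have hvT : ∀ a, HasLink (qv a) (link (sq k l hkl (dn x j)) a) := fun a => by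
      rw [hvJ a]; exact hasLink_ring_low hjk hjl hkl (dn x j) a
    have hvT' : ∀ a b, HasLink (qv b) (link (sq k l hkl (dn x j)) a) → b = a := fun a b h => by
      rw [hvJ b] at h; exact eq_of_hasLink_ring_low hjk hjl hkl hL3 h
    rcases huu with huI | huJ
    · right; right; left
      have hTB := sq_eq_of_links hkl hL3 (match_links hij hjk hkl hc hL hρ hz₀ hω hx hz hv hu hex hT hT2 hvT hvT' fun a b h => ((huB _ hT2 a b h).1 (huI b)))
      have hzx : z = (dn x j).shift i := by rw [hTB, dn_shift]
      refine ⟨hzx, ?_⟩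
      have hqv : qv = ring hjk hjl (dn x j) := funext hvJ
      have hqu : qu = ring hik hil (dn x j) := funext fun a => by rw [huI a, ← hTB]
      rw [hQeq, hqv, hqu]
    · right; right; right
      have hTB := sq_eq_of_links hkl hL3 (match_links hij hjk hkl hc hL hρ hz₀ hω hx hz hv hu hex hT hT2 hvT hvT' fun a b h => ((huB _ hT2 a b h).2 (huJ b)))
      have hzx : z = dn (dn x j) j := by rw [hTB, shift_dn]
      refine ⟨hzx, ?_⟩
      have hqv : qv = ring hjk hjl (dn x j) := funext hvJ
      have hqu : qu = ring hjk hjl z := funext huJ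
      rw [hQeq, hqv, hqu]

include hij hjk hkl hc hL hρ hz₀ hω hx hz in
/-- **No tube offset, no small term**: if `z` is none of `x + 2e_i`, `x + e_i - e_j`,
`x - 2e_j` then every back-expansion term with `|Q| ≤ 8` vanishes. -/
theorem pairT_eq_zero_of_ne_offsets (h1 : z ≠ (x.shift i).shift i) (h2 : z ≠ dn (x.shift i) j)
    (h3 : z ≠ (dn x j).shift i) (h4 : z ≠ dn (dn x j) j) {Q : Finset (Plaquette d L)}
    (hQ : Q ⊆ restPlaqs i j c) (hcard : Q.card ≤ 8) : pairT ρ β Q (sq k l hkl z) (sq k l hkl x) = 0 := by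
  by_contra hT
  rcases tube_shape hij hjk hkl hc hL hρ hz₀ hω hx hz hQ hcard hT with
    ⟨h, -⟩ | ⟨h, -⟩ | ⟨h, -⟩ | ⟨h, -⟩
  · exact h1 h
  · exact h2 h
  · exact h3 h
  · exact h4 h

include hij in
omit [NeZero L] in
/-- The four offsets are distinct from `x + 2e_i` except the first (`L ≥ 3`). -/
theorem shift_shift_i_ne (hL3 : 3 ≤ L) :
    (x.shift i).shift i ≠ dn (x.shift i) j ∧ (x.shift i).shift i ≠ (dn x j).shift i ∧
      (x.shift i).shift i ≠ dn (dn x j) j := by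
  have hij' : i ≠ j := ne_of_lt hij
  have h1 := one_ne_zero_of_three_le hL3
  have h2 := two_ne_zero_of_three_le hL3
  refine ⟨fun h => ?_, fun h => ?_, fun h => ?_⟩
  · have e := congrFun h i
    simp only [Site.shift, dn, Pi.add_apply, Pi.sub_apply, Pi.single_eq_same,
      Pi.single_eq_of_ne hij'] at e
    exact h1 (by linear_combination e)
  · have e := congrFun h i
    simp only [Site.shift, dn, Pi.add_apply, Pi.sub_apply, Pi.single_eq_same,
      Pi.single_eq_of_ne hij'] at e
    exact h1 (by linear_combination e)
  · have e := congrFun h i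
    simp only [Site.shift, dn, Pi.add_apply, Pi.sub_apply, Pi.single_eq_same,
      Pi.single_eq_of_ne hij'] at e
    exact h2 (by linear_combination e)

include hij in
omit [NeZero L] in
/-- The four offsets are distinct from `x - 2e_j` except the last (`L ≥ 3`). -/
theorem dn_dn_j_ne (hL3 : 3 ≤ L) :
    dn (dn x j) j ≠ (x.shift i).shift i ∧ dn (dn x j) j ≠ dn (x.shift i) j ∧
      dn (dn x j) j ≠ (dn x j).shift i := by
  have hij' : i ≠ j := ne_of_lt hij
  have h1 := one_ne_zero_of_three_le hL3
  have h2 := two_ne_zero_of_three_le hL3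
  refine ⟨fun h => ?_, fun h => ?_, fun h => ?_⟩
  · have e := congrFun h i
    simp only [Site.shift, dn, Pi.add_apply, Pi.sub_apply, Pi.single_eq_same,
      Pi.single_eq_of_ne hij'] at e
    exact h2 (by linear_combination -e)
  · have e := congrFun h i
    simp only [Site.shift, dn, Pi.add_apply, Pi.sub_apply, Pi.single_eq_same,
      Pi.single_eq_of_ne hij'] at e
    exact h1 (by linear_combination -e)
  · have e := congrFun h i
    simp only [Site.shift, dn, Pi.add_apply, Pi.sub_apply, Pi.single_eq_same,
      Pi.single_eq_of_ne hij'] at e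
    exact h1 (by linear_combination -e)

include hij hjk hkl hc hL hρ hz₀ hω hx hz in
/-- ★ **The straight `i`-tube**: for `z = x + 2e_i`, a non-zero term with `|Q| ≤ 8` is the set of
the eight `+e_i` ring faces over `x` and over `x + e_i`. -/
theorem eq_tubeI_of_pairT_ne_zero (hzx : z = (x.shift i).shift i) {Q : Finset (Plaquette d L)}
    (hQ : Q ⊆ restPlaqs i j c) (hcard : Q.card ≤ 8) (hT : pairT ρ β Q (sq k l hkl z) (sq k l hkl x) ≠ 0) :
    Q = univ.image (ring (hij.trans hjk) (hij.trans (hjk.trans hkl)) x) ∪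
      univ.image (ring (hij.trans hjk) (hij.trans (hjk.trans hkl)) (x.shift i)) := by
  obtain ⟨n1, n2, n3⟩ := shift_shift_i_ne (x := x) hij (by omega : 3 ≤ L)
  rcases tube_shape hij hjk hkl hc hL hρ hz₀ hω hx hz hQ hcard hT with
    ⟨-, h⟩ | ⟨h, -⟩ | ⟨h, -⟩ | ⟨h, -⟩
  · exact h
  · exact absurd (hzx.symm.trans h) n1
  · exact absurd (hzx.symm.trans h) n2
  · exact absurd (hzx.symm.trans h) n3

include hij hjk hkl hc hL hρ hz₀ hω hx hz in
/-- ★ **The straight `j`-tube**: for `z = x - 2e_j`, a non-zero term with `|Q| ≤ 8` is the set of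
the eight `j`-ring faces based at `x - e_j` and at `x - 2e_j`. -/
theorem eq_tubeJ_of_pairT_ne_zero (hzx : z = dn (dn x j) j) {Q : Finset (Plaquette d L)}
    (hQ : Q ⊆ restPlaqs i j c) (hcard : Q.card ≤ 8) (hT : pairT ρ β Q (sq k l hkl z) (sq k l hkl x) ≠ 0) :
    Q = univ.image (ring hjk (hjk.trans hkl) (dn x j)) ∪ univ.image (ring hjk (hjk.trans hkl) z) := by
  obtain ⟨n1, n2, n3⟩ := dn_dn_j_ne (x := x) hij (by omega : 3 ≤ L)
  rcases tube_shape hij hjk hkl hc hL hρ hz₀ hω hx hz hQ hcard hT with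
    ⟨h, -⟩ | ⟨h, -⟩ | ⟨h, -⟩ | ⟨-, h⟩
  · exact absurd (hzx.symm.trans h) n1
  · exact absurd (hzx.symm.trans h) n2
  · exact absurd (hzx.symm.trans h) n3
  · exact h

end Match

end DiagRPTube

end

end Summit.QuantumFields.GaugeBoot
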